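import Summits.CriticalPhenomena.PercolationContinuityZ3.Theorems.PercNearOneGluingNoHeavyLowerTailKNConjecture1Monotone
import Summits.CriticalPhenomena.PercolationContinuityZ3.Theorems.PercNearOneGluingNoHeavyLowerTailKNConjecture4Min
import Summits.CriticalPhenomena.PercolationContinuityZ3.Theorems.PercNearOneGluingNoHeavyLowerTailKNQuestion7AllRelays
import HarnessLib

/-!
# Kozma–Nitzan's Conjectures 1 (monotone form) and 4 in their PRINTED generality: cluster properties monotone along
# nonempty vertex sets

Support file (`--supports stmt-CriticalPhenomena-4575`), cell perc-kn (req609-KN), file F11, lead `perc-kn-lead` (gen2).  No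
definitions, no named facts, no sorries; standard axioms.

Kozma–Nitzan's requirement (1) of §5.1 (arXiv:2401.12397, p. 31) — "`f(v, ω)` depends only on `C_ω(v)` … and is increasing in
it" — constrains `f(v, ω) = F(C_ω(v))` only along NONEMPTY vertex sets (a cluster contains its base point), whereas the tree's
all-weights theorems `kn_conjecture1_monotone` (F2), `PreFKGSurplus.kn_conj4` / `PreFKGSurplus.kn_conj4_min` (F10) and
`Q7Psi.kn_conj4_designated` ask `F` to be monotone on ALL vertex sets.  The two readings are equivalent for these statements: such an
`F` agrees on nonempty sets with a globally monotone one (`KNPreFKG.monotoneOnNonempty_extension`, value `min_v F{v}` at `∅`), and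
`F` is only ever read on clusters.  This file records the four statements in the printed generality, exactly as
`UniversalGluing.universal_coefficients_clusterProperty` does for Question 5.
[cite: KozmaNitzan2024, §5.1 (p. 31), Conj. 1 (p. 3), Conj. 4 (p. 32)]
-/

noncomputable section

namespace Summit.CriticalPhenomena.PercolationContinuityZ3.Theorems

open MeasureTheory Set
open Literature.Probability.LatticeModels (prodBernoulli)
open Literature.Probability.Percolation
open scoped Classical

/-- **Kozma–Nitzan's Conjecture 1 for monotone cluster properties in the printed generality** (every weight vector in `[0,1]^E`):
for `F` increasing along nonempty vertex sets, `A ≠ ∅` and any `o`, `μ(o ↔ A)·min_{a∈A} E F(C_a) ≤ E[F(C_o); o ↔ A]`.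
(`kn_conjecture1_monotone` via `KNPreFKG.monotoneOnNonempty_extension`.) [cite: KozmaNitzan2024, Conj. 1 (p. 3), §5.1 (p. 31)] -/
theorem kn_conjecture1_clusterProperty (n : ℕ) (w : Sym2 (Fin n) → unitInterval) (A : Finset (Fin n)) (hA : A.Nonempty)
    (o : Fin n) (F : Set (Fin n) → ℝ) (hF : ∀ S S' : Set (Fin n), S.Nonempty → S ⊆ S' → F S ≤ F S') :
    (prodBernoulli w).real (⋃ a ∈ A, openConn o a) * A.inf' hA (fun a => ∫ ω, F (openCluster ω a) ∂(prodBernoulli w)) ≤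
      ∫ ω in (⋃ a ∈ A, openConn o a), F (openCluster ω o) ∂(prodBernoulli w) := by
  obtain ⟨F', hF'mono, hF'eq⟩ := KNPreFKG.monotoneOnNonempty_extension o F hF
  have hx : ∀ (x : Fin n) (ω : BondConfig (Fin n)), F (openCluster ω x) = F' (openCluster ω x) :=
    fun x ω => (hF'eq _ ⟨x, mem_openCluster_self ω x⟩).symm
  have h := kn_conjecture1_monotone n w A hA o F' hF'mono
  simp_rw [← hx] at h
  exact h

namespace PreFKGSurplus

/-- **Kozma–Nitzan's Conjecture 4 in the printed generality, `∃`-form** (every weight vector): for `F` increasing along nonempty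
vertex sets, `A ≠ ∅` and any `o`, some `a ∈ A` has `E[F(C_a); o ↔ A] ≤ E[F(C_o); o ↔ A]`.
(`PreFKGSurplus.kn_conj4` via `KNPreFKG.monotoneOnNonempty_extension`.) [cite: KozmaNitzan2024, Conj. 4 (p. 32), §5.1 (p. 31)] -/
theorem kn_conj4_clusterProperty {n : ℕ} (w : Sym2 (Fin n) → unitInterval) (A : Finset (Fin n)) (o : Fin n)
    (F : Set (Fin n) → ℝ) (hF : ∀ S T : Set (Fin n), S.Nonempty → S ⊆ T → F S ≤ F T) (hA : A.Nonempty) :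
    ∃ a ∈ A, ∫ ω in ⋃ a' ∈ A, openConn o a', F (openCluster ω a) ∂(prodBernoulli w) ≤
      ∫ ω in ⋃ a' ∈ A, openConn o a', F (openCluster ω o) ∂(prodBernoulli w) := by
  obtain ⟨F', hF'mono, hF'eq⟩ := KNPreFKG.monotoneOnNonempty_extension o F hF
  have hx : ∀ (x : Fin n) (ω : BondConfig (Fin n)), F (openCluster ω x) = F' (openCluster ω x) :=
    fun x ω => (hF'eq _ ⟨x, mem_openCluster_self ω x⟩).symm
  have h := kn_conj4 w A o F' hF'mono hA
  simp_rw [← hx] at h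
  exact h

/-- **Kozma–Nitzan's Conjecture 4 in the printed generality, `min`-form** (every weight vector): for `F` increasing along nonempty
vertex sets, `A ≠ ∅` and any `o`, `min_{a∈A} E[F(C_a); o ↔ A] ≤ E[F(C_o); o ↔ A]`.
(`PreFKGSurplus.kn_conj4_min` via `KNPreFKG.monotoneOnNonempty_extension`.) [cite: KozmaNitzan2024, Conj. 4 (p. 32), §5.1 (p. 31)] -/
theorem kn_conj4_min_clusterProperty {n : ℕ} (w : Sym2 (Fin n) → unitInterval) (A : Finset (Fin n)) (hA : A.Nonempty)
    (o : Fin n) (F : Set (Fin n) → ℝ) (hF : ∀ S T : Set (Fin n), S.Nonempty → S ⊆ T → F S ≤ F T) :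
    A.inf' hA (fun a => ∫ ω in ⋃ a' ∈ A, openConn o a', F (openCluster ω a) ∂(prodBernoulli w)) ≤
      ∫ ω in ⋃ a' ∈ A, openConn o a', F (openCluster ω o) ∂(prodBernoulli w) := by
  obtain ⟨F', hF'mono, hF'eq⟩ := KNPreFKG.monotoneOnNonempty_extension o F hF
  have hx : ∀ (x : Fin n) (ω : BondConfig (Fin n)), F (openCluster ω x) = F' (openCluster ω x) :=
    fun x ω => (hF'eq _ ⟨x, mem_openCluster_self ω x⟩).symm
  have h := kn_conj4_min w A hA o F' hF'mono
  simp_rw [← hx] at h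
  exact h

end PreFKGSurplus

namespace Q7Psi

/-- **The pre-FKG inequality at every minimiser, printed generality** (every weight vector): for `F` increasing along nonempty
vertex sets and `c ∈ A` minimising `a ↦ E F(C_a)` over `A`, `E[F(C_c); o ↔ A] ≤ E[F(C_o); o ↔ A]`.
(`Q7Psi.kn_conj4_designated` via `KNPreFKG.monotoneOnNonempty_extension`.) [cite: KozmaNitzan2024, Conj. 4 (p. 32), §5.1 (p. 31), Question 7 (p. 36)] -/
theorem kn_conj4_designated_clusterProperty {n : ℕ} (w : Sym2 (Fin n) → unitInterval) (A : Finset (Fin n)) (o c : Fin n)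
    (F : Set (Fin n) → ℝ) (hF : ∀ S T : Set (Fin n), S.Nonempty → S ⊆ T → F S ≤ F T) (hcA : c ∈ A)
    (hcmin : ∀ a ∈ A, ∫ ω, F (openCluster ω c) ∂(prodBernoulli w) ≤ ∫ ω, F (openCluster ω a) ∂(prodBernoulli w)) :
    ∫ ω in ⋃ a ∈ A, openConn o a, F (openCluster ω c) ∂(prodBernoulli w) ≤
      ∫ ω in ⋃ a ∈ A, openConn o a, F (openCluster ω o) ∂(prodBernoulli w) := by
  obtain ⟨F', hF'mono, hF'eq⟩ := KNPreFKG.monotoneOnNonempty_extension o F hF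
  have hx : ∀ (x : Fin n) (ω : BondConfig (Fin n)), F (openCluster ω x) = F' (openCluster ω x) :=
    fun x ω => (hF'eq _ ⟨x, mem_openCluster_self ω x⟩).symm
  have hcmin' : ∀ a ∈ A, ∫ ω, F' (openCluster ω c) ∂(prodBernoulli w) ≤ ∫ ω, F' (openCluster ω a) ∂(prodBernoulli w) := by
    intro a ha
    have h := hcmin a ha
    simp_rw [hx] at h
    exact h
  have h := kn_conj4_designated w A o c F' hF'mono hcA hcmin'
  simp_rw [← hx] at h
  exact h

end Q7Psi

end Summit.CriticalPhenomena.PercolationContinuityZ3.Theorems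

end
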